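import Summits.QuantumFields.YangMills.Theorems.IR.AfPincerUcPortBox
import Summits.QuantumFields.YangMills.Theorems.OneCertifiedCubeFiniteSizeCriterionTorus
import Literature.MathematicalPhysics.QuantumLattice.LatticeGaugeDLRBoxKernels
import Literature.MathematicalPhysics.QuantumLattice.ContinuumLimitLGT
import Literature.MathematicalPhysics.QuantumFieldTheory.YangMillsOS

/-!
# The port of `stub_typCriterionUc` (line `af-pincer-Uc`, crux `IR`): torus bookkeeping — clustering on the tori from a
# per-box uniform two-exterior influence bound

Helper theorem for item `stmt-QuantumFields-19354` (crux `IR`; architecture δ' of `MEMO-g6-port-map.md`, seat ym-cruxidea-19354-1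
g6, §3 table row P6b; this is the memo's `TorusBookkeepingT` with its hypothesis SPELLED OUT for the uniform mesh-`b` frame, so
that the module stays outside every route-file cone).

`torus_clustering_of_box_influence θ C₁`: for `θ ∈ (0,1)`, `C₁ ≥ 0` there is `κ = -log θ / 2 > 0` such that for every compact
metrisable `G`, continuous `ρ` and local gauge-invariant observables `A, B` there is `C` with: whenever at coupling `β` and mesh
`b ≥ 1` the Wilson kernels of the inner cells of every box of the uniform frame `j ↦ b j` obey the per-box uniform influence bound
`|γ_{inner} f(η) − γ_{inner} f(η')| ≤ C₁ e^{#Δf} #rind θ^D` (cylinder observables `f ∈ [0,1]` of inner cells `Δf` at cell-distance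
`≥ D` from the rind, all exteriors), then `|⟨A ; τ_t B⟩_{2S+1}| ≤ C e^{−κ t / b}` for all `t ≤ S`.

Proof (route-8895 pattern, `Theorems.OneCertifiedCubeFiniteSizeCriterion`): the box of `2L+3` cells per side centred at the
origin, `b (L + 1) + R_B ≤ t`, `L = R_A + k`, injects with its collar into the torus and misses the time-`t` translate of the
support of `B`, so `FiniteSizeCriterion.abs_latticeConnectedCorr_le_of_influence` bounds the correlation by
`2 (‖A‖+1) ‖B‖ C₁ e^{(2R_A+1)⁴} (2L+3)⁴ θ^{k+1}`; the polynomial factor is absorbed by half of the decay (`u⁴ e^{−κu} ≤ 24/κ⁴`).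

HONEST FRAMING: bookkeeping for one stub of one open gap-crux of a CONDITIONAL chain; no claim about the crux or the gap.
-/

set_option autoImplicit false

noncomputable section

open MeasureTheory Filter
open Literature.Probability.LatticeModels
open Literature.MathematicalPhysics.QuantumLattice
open Literature.MathematicalPhysics.QuantumFieldTheory (wilsonMeasure isProbabilityMeasure_wilsonMeasure
  latticeConnectedCorr)
open Summit.QuantumFields.YangMills.Cruxes.IR.Tempered (cellEdges regionEdges)
open Summit.QuantumFields.YangMills.Theorems.FiniteSizeCriterion (abs_latticeConnectedCorr_le_of_influence)

namespace Summit.QuantumFields.YangMills.Cruxes.IR.AfPincerUc.Port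

/-! ## Arithmetic helpers -/

/-- Reduction mod `M` is injective on a box of sites of width `< M` (copy of route-8895's
`FiniteSizeCriterion.injOn_torusProj_of_width`, kept private to stay outside that route's import cone). -/
private theorem injOn_torusProj_of_width' {M : ℕ} {lo hi : ℤ} (hw : hi - lo < M) :
    Set.InjOn (Torus.proj M) {x : Site 4 | ∀ i, lo ≤ x i ∧ x i ≤ hi} := by
  intro x hx y hy hxy
  funext i
  have h1 : ((x i : ℤ) : ZMod M) = ((y i : ℤ) : ZMod M) := congr_fun hxy i
  rw [ZMod.intCast_eq_intCast_iff_dvd_sub] at h1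
  have h3 : |y i - x i| < (M : ℤ) := by
    rw [abs_lt]
    constructor <;> linarith [(hx i).1, (hx i).2, (hy i).1, (hy i).2]
  linarith [Int.eq_zero_of_abs_lt_dvd h1 h3]

/-- Polynomial × exponential: `u⁴ e^{−κ u} ≤ 24 / κ⁴` for `κ > 0`, `u ≥ 0`. -/
private theorem pow_four_mul_exp_neg_le {κ u : ℝ} (hκ : 0 < κ) (hu : 0 ≤ u) :
    u ^ 4 * Real.exp (-(κ * u)) ≤ 24 / κ ^ 4 := by
  have h := Real.pow_div_factorial_le_exp (κ * u) (by positivity) 4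
  have h24 : ((Nat.factorial 4 : ℕ) : ℝ) = 24 := by norm_num [Nat.factorial]
  rw [h24, div_le_iff₀ (by norm_num : (0 : ℝ) < 24)] at h
  rw [le_div_iff₀ (pow_pos hκ 4)]
  have hexp : Real.exp (-(κ * u)) * Real.exp (κ * u) = 1 := by
    rw [← Real.exp_add, neg_add_cancel, Real.exp_zero]
  have h0 : 0 ≤ Real.exp (-(κ * u)) := (Real.exp_pos _).le
  calc u ^ 4 * Real.exp (-(κ * u)) * κ ^ 4 = (κ * u) ^ 4 * Real.exp (-(κ * u)) := by ring
    _ ≤ Real.exp (κ * u) * 24 * Real.exp (-(κ * u)) := mul_le_mul_of_nonneg_right h h0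
    _ = 24 := by rw [mul_assoc, mul_comm (Real.exp (κ * u)), mul_assoc, hexp]; ring

/-! ## The theorem -/

/-- **Torus bookkeeping (architecture δ', piece P6b): a per-box uniform two-exterior influence bound for the uniform
mesh-`b` frame gives exponential clustering at rate `κ/b`, `κ = -log θ / 2`, on every torus, constants uniform in
`β, b, S`.**  See the module docstring. -/
theorem torus_clustering_of_box_influence (θ C₁ : ℝ) (hθ : 0 < θ) (hθ1 : θ < 1) (hC₁ : 0 ≤ C₁) :
    ∃ κ : ℝ, 0 < κ ∧
    ∀ {G : Type} [Group G] [TopologicalSpace G] [IsTopologicalGroup G] [CompactSpace G] [MeasurableSpace G]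
      [BorelSpace G] [T2Space G] [SecondCountableTopology G] {N : ℕ} (ρ : G →* Matrix (Fin N) (Fin N) ℂ),
      Continuous ρ → ∀ A B : LocalGaugeObservable 4 G, ∃ C : ℝ, ∀ (β : ℝ) (b : ℕ), 1 ≤ b →
        (∀ (x₀ : Fin 4 → ℤ) (m : ℕ), 3 ≤ m → ∀ Δf : Finset (Fin 4 → ℤ), Δf ⊆ innerCells x₀ m →
          ∀ D : ℕ, (∀ x ∈ Δf, ∀ y ∈ rindCells x₀ m, D ≤ cellDist x y) →
            ∀ f : LGConfig 4 G → ℝ, IsCylinder f (regionEdges (fun _ j => (b : ℤ) * j) Δf) → Measurable f →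
              (∀ U, 0 ≤ f U ∧ f U ≤ 1) → ∀ η η' : LGConfig 4 G,
                |(∫ U, f U ∂(ymSpecification ρ β (regionEdges (fun _ j => (b : ℤ) * j) (innerCells x₀ m)) η)) -
                    ∫ U, f U ∂(ymSpecification ρ β (regionEdges (fun _ j => (b : ℤ) * j) (innerCells x₀ m)) η')| ≤
                  C₁ * Real.exp (Δf.card) * (rindCells x₀ m).card * θ ^ D) →
        ∀ S t : ℕ, t ≤ S → |latticeConnectedCorr ρ β (2 * S + 1) A.F B.F t| ≤ C * Real.exp (-(κ * t / b)) := by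
  -- the rate
  have hlogθ : Real.log θ < 0 := Real.log_neg hθ hθ1
  set κ : ℝ := -Real.log θ / 2 with hκ
  have hκ0 : 0 < κ := by rw [hκ]; linarith
  have hlogκ : Real.log θ = -(2 * κ) := by rw [hκ]; ring
  refine ⟨κ, hκ0, ?_⟩
  intro G _ _ _ _ _ _ _ _ N ρ hρc A B
  obtain ⟨CA, hCA⟩ := A.bounded
  obtain ⟨CB, hCB⟩ := B.bounded
  have hCA0 : 0 ≤ CA := (abs_nonneg _).trans (hCA fun _ => 1)
  have hCB0 : 0 ≤ CB := (abs_nonneg _).trans (hCB fun _ => 1)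
  -- the radii of the supports
  set RA : ℕ := A.supp.sup fun e => Finset.univ.sup fun i => (e.1 i).natAbs
  set RB : ℕ := B.supp.sup fun e => Finset.univ.sup fun i => (e.1 i).natAbs
  have hRA : ∀ e ∈ A.supp, ∀ i, |e.1 i| ≤ RA := fun e he i => by
    rw [Int.abs_eq_natAbs, Int.ofNat_le]
    exact (Finset.le_sup (f := fun i => (e.1 i).natAbs) (Finset.mem_univ i)).trans
      (Finset.le_sup (f := fun e : ZdEdge 4 => Finset.univ.sup fun i => (e.1 i).natAbs) he)
  have hRB : ∀ e ∈ B.supp, ∀ i, |e.1 i| ≤ RB := fun e he i => by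
    rw [Int.abs_eq_natAbs, Int.ofNat_le]
    exact (Finset.le_sup (f := fun i => (e.1 i).natAbs) (Finset.mem_univ i)).trans
      (Finset.le_sup (f := fun e : ZdEdge 4 => Finset.univ.sup fun i => (e.1 i).natAbs) he)
  clear_value RA RB
  -- the cells carrying the support of `A`
  set Δf : Finset (Fin 4 → ℤ) := Fintype.piFinset fun _ : Fin 4 => Finset.Icc (-(RA : ℤ)) RA with hΔf
  -- the constant
  set K : ℝ := C₁ * Real.exp (Δf.card) * ((2 * RA + 3 : ℝ) ^ 4) * (24 / κ ^ 4) with hK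
  have hK0 : 0 ≤ K := by rw [hK]; positivity
  set c0 : ℝ := RA + RB + 2 with hc0
  refine ⟨2 * (CA + 1) * CB * (1 + K) * Real.exp (κ * c0), ?_⟩
  intro β b hb hbox S t ht
  haveI := isProbabilityMeasure_wilsonMeasure (d := 4) (L := 2 * S + 1) ρ hρc β
  have hb0 : (0 : ℤ) < b := by exact_mod_cast hb
  have hbR : (1 : ℝ) ≤ b := by exact_mod_cast hb
  have hbR0 : (0 : ℝ) < b := by linarith
  -- the trivial bound
  have htriv : |latticeConnectedCorr ρ β (2 * S + 1) A.F B.F t| ≤ 2 * (CA + 1) * CB := by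
    unfold Literature.MathematicalPhysics.QuantumFieldTheory.latticeConnectedCorr
    have h1 : |∫ U, A.F (torusLift (2 * S + 1) U) *
        B.F (Literature.MathematicalPhysics.QuantumLattice.configShift (-Pi.single 0 (t : ℤ))
          (torusLift (2 * S + 1) U)) ∂(wilsonMeasure (d := 4) (L := 2 * S + 1) ρ β)| ≤ CA * CB :=
      abs_integral_le_of_abs_le fun U => by
        rw [abs_mul]
        exact mul_le_mul (hCA _) (hCB _) (abs_nonneg _) hCA0
    have h2 : |∫ U, A.F (torusLift (2 * S + 1) U) ∂(wilsonMeasure (d := 4) (L := 2 * S + 1) ρ β)| ≤ CA :=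
      abs_integral_le_of_abs_le fun U => hCA _
    have h3 : |∫ U, B.F (torusLift (2 * S + 1) U) ∂(wilsonMeasure (d := 4) (L := 2 * S + 1) ρ β)| ≤ CB :=
      abs_integral_le_of_abs_le fun U => hCB _
    calc _ ≤ |∫ U, A.F (torusLift (2 * S + 1) U) *
          B.F (Literature.MathematicalPhysics.QuantumLattice.configShift (-Pi.single 0 (t : ℤ))
            (torusLift (2 * S + 1) U)) ∂(wilsonMeasure (d := 4) (L := 2 * S + 1) ρ β)| +
          |(∫ U, A.F (torusLift (2 * S + 1) U) ∂(wilsonMeasure (d := 4) (L := 2 * S + 1) ρ β)) *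
            ∫ U, B.F (torusLift (2 * S + 1) U) ∂(wilsonMeasure (d := 4) (L := 2 * S + 1) ρ β)| :=
          abs_sub _ _
      _ ≤ CA * CB + CA * CB := by
          rw [abs_mul]
          exact add_le_add h1 (mul_le_mul h2 h3 (abs_nonneg _) hCA0)
      _ = 2 * CA * CB := by ring
      _ ≤ 2 * (CA + 1) * CB := by nlinarith
  have hgoal : ∀ {x : ℝ}, x ≤ 2 * (CA + 1) * CB * (1 + K) * Real.exp (κ * c0 - κ * t / b) →
      x ≤ 2 * (CA + 1) * CB * (1 + K) * Real.exp (κ * c0) * Real.exp (-(κ * t / b)) := by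
    intro x hx
    rwa [mul_assoc _ (Real.exp _), ← Real.exp_add, ← sub_eq_add_neg]
  have hpref0 : 0 ≤ 2 * (CA + 1) * CB * (1 + K) := by positivity
  obtain ⟨P, hP⟩ : ∃ P : ℕ, P = b * (RA + 1) := ⟨_, rfl⟩
  by_cases hcase : b ≤ t - RB - P
  swap
  · -- few cells between the supports: the trivial bound suffices
    apply hgoal
    have htlt : t < b + RB + P := by omega
    have htb : (t : ℝ) ≤ b * c0 := by
      have h1 : (t : ℝ) < b + RB + P := by exact_mod_cast htlt
      have h3 : (P : ℝ) = b * (RA + 1) := by rw [hP]; push_cast; ring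
      have h4 : (RB : ℝ) ≤ b * RB := le_mul_of_one_le_left (by positivity) hbR
      rw [hc0]
      nlinarith only [h1, h3, h4]
    have hexp : 1 ≤ Real.exp (κ * c0 - κ * t / b) := by
      refine Real.one_le_exp ?_
      rw [sub_nonneg, mul_div_assoc]
      exact mul_le_mul_of_nonneg_left ((div_le_iff₀ hbR0).2 (by linarith only [htb])) hκ0.le
    calc |latticeConnectedCorr ρ β (2 * S + 1) A.F B.F t| ≤ 2 * (CA + 1) * CB := htriv
      _ = 2 * (CA + 1) * CB * 1 * 1 := by ring
      _ ≤ 2 * (CA + 1) * CB * (1 + K) * Real.exp (κ * c0 - κ * t / b) := by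
          gcongr
          linarith
  · -- the main case
    apply hgoal
    obtain ⟨k, hk⟩ : ∃ k : ℕ, k = (t - RB - P) / b := ⟨_, rfl⟩
    have hkb : k * b ≤ t - RB - P := by rw [hk]; exact Nat.div_mul_le_self _ _
    have hlt : t - RB - P < k * b + b := by rw [hk]; exact Nat.lt_div_mul_add (by omega)
    have ht_eq : t - RB - P + RB + P = t := by omega
    obtain ⟨L, hL⟩ : ∃ L : ℕ, L = RA + k := ⟨_, rfl⟩
    -- integer forms of the separation facts
    have hb1 : (1 : ℤ) ≤ b := by exact_mod_cast hb
    have hI1 : (b : ℤ) * L + b + RB ≤ t := by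
      have h : ((k * b + RB + P : ℕ) : ℤ) ≤ t := by exact_mod_cast (show k * b + RB + P ≤ t by omega)
      rw [hP] at h; push_cast at h; rw [hL]; push_cast; ring_nf at h ⊢; linarith only [h]
    have hI2 : (t : ℤ) ≤ S := by exact_mod_cast ht
    have hRAL : (RA : ℤ) ≤ L := by rw [hL]; push_cast; linarith only [(Nat.cast_nonneg k : (0 : ℤ) ≤ k)]
    have hLbL : (L : ℤ) ≤ b * L := le_mul_of_one_le_left (by positivity) hb1
    -- the frame, the box, the cells
    set w : Fin 4 → ℤ → ℤ := fun _ j => (b : ℤ) * j with hw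
    have hw1 : ∀ i j, w i j + 1 ≤ w i (j + 1) := by intro i j; simp only [hw]; nlinarith only [hb1]
    set x₀ : Fin 4 → ℤ := fun _ => -(L : ℤ) - 1 with hx₀
    obtain ⟨m, hm⟩ : ∃ m : ℕ, m = 2 * L + 3 := ⟨_, rfl⟩
    have hm3 : 3 ≤ m := by omega
    have hΔfin : Δf ⊆ innerCells x₀ m := by
      intro x hx
      rw [mem_innerCells_iff]
      intro i
      have h := Finset.mem_Icc.1 (Fintype.mem_piFinset.1 hx i)
      simp only [hx₀, hm]; push_cast
      constructor <;> linarith only [h.1, h.2, hRAL]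
    have hD : ∀ x ∈ Δf, ∀ y ∈ rindCells x₀ m, k + 1 ≤ cellDist x y := by
      intro x hx y hy
      obtain ⟨hyB, hyI⟩ := Finset.mem_sdiff.1 hy
      rw [mem_boxCells_iff] at hyB
      rw [mem_innerCells_iff] at hyI
      push Not at hyI
      obtain ⟨i, hi⟩ := hyI
      have hxi := Finset.mem_Icc.1 (Fintype.mem_piFinset.1 hx i)
      have hyi := hyB i
      simp only [hx₀, hm] at hyi hi; push_cast at hyi hi
      have habs := abs_sub_le_cellDist x y i
      have hy_ext : y i ≤ -(L : ℤ) - 1 ∨ (L : ℤ) + 1 ≤ y i := by omega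
      have : ((k + 1 : ℕ) : ℤ) ≤ (cellDist x y : ℤ) := by
        push_cast
        rw [hL] at hy_ext; push_cast at hy_ext
        rcases hy_ext with h1 | h1
        · have : (k + 1 : ℤ) ≤ x i - y i := by linarith only [h1, hxi.1]
          linarith only [this, habs, le_abs_self (x i - y i)]
        · have : (k + 1 : ℤ) ≤ y i - x i := by linarith only [h1, hxi.2]
          have habs' : |y i - x i| ≤ (cellDist x y : ℤ) := by rw [abs_sub_comm]; exact habs
          linarith only [this, habs', le_abs_self (y i - x i)]
      exact_mod_cast this
    -- the normalised observable
    set CA' : ℝ := CA + 1 with hCA'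
    have hCA'0 : 0 < CA' := by rw [hCA']; linarith
    set f : LGConfig 4 G → ℝ := fun U => A.F U / (2 * CA') + 1 / 2 with hf
    have hf01 : ∀ U, 0 ≤ f U ∧ f U ≤ 1 := by
      intro U
      have h := abs_le.1 ((hCA U).trans (show CA ≤ CA' by rw [hCA']; linarith))
      simp only [hf]
      constructor
      · rw [div_add' _ _ _ (by positivity), le_div_iff₀ (by positivity)]; linarith only [h.1]
      · rw [div_add' _ _ _ (by positivity), div_le_iff₀ (by positivity)]; linarith only [h.2]
    have hfm : Measurable f := (A.measurable.div_const _).add_const _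
    have hfS : IsCylinder f (regionEdges w Δf) := by
      intro U U' hUU'
      simp only [hf]
      rw [A.isCylinder fun e he => hUU' e ?_]
      rw [Finset.mem_coe, mem_regionEdges_iff hw1]
      rw [hΔf, Fintype.mem_piFinset]
      intro i
      have h1 := abs_le.1 (hRA e (Finset.mem_coe.1 he) i)
      -- the cell of `e` in the uniform frame: `⌊e.1 i / b⌋`
      have hcell := (Summit.QuantumFields.YangMills.Cruxes.IR.CellTempered.Engine.frameCell_eq_iff hw1 e
        (Summit.QuantumFields.YangMills.Cruxes.IR.CellTempered.Engine.frameCell w e)).1 rfl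
      simp only [Summit.QuantumFields.YangMills.Cruxes.IR.Tempered.cellEdges, Finset.mem_product, Finset.mem_univ,
        and_true, Fintype.mem_piFinset, Finset.mem_Ico, hw] at hcell
      have h2 := hcell i
      rw [Finset.mem_Icc]
      constructor
      · by_contra hlt'; push Not at hlt'
        have : (b : ℤ) * (Summit.QuantumFields.YangMills.Cruxes.IR.CellTempered.Engine.frameCell w e i + 1) ≤
            (b : ℤ) * (-(RA : ℤ)) := mul_le_mul_of_nonneg_left (by omega) hb0.le
        nlinarith only [this, h2.2, h1.1, hb1]
      · by_contra hlt'; push Not at hlt'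
        have : (b : ℤ) * ((RA : ℤ) + 1) ≤
            (b : ℤ) * Summit.QuantumFields.YangMills.Cruxes.IR.CellTempered.Engine.frameCell w e i :=
          mul_le_mul_of_nonneg_left (by omega) hb0.le
        nlinarith only [this, h2.1, h1.2, hb1]
    -- the influence bound for `f`, then for `A.F = 2 CA' (f − 1/2)`
    have hinfl := hbox x₀ m hm3 Δf hΔfin (k + 1) hD f hfS hfm hf01
    set Λ : Finset (ZdEdge 4) := regionEdges w (innerCells x₀ m) with hΛ
    set Δ : ℝ := C₁ * Real.exp (Δf.card) * (rindCells x₀ m).card * θ ^ (k + 1) with hΔdef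
    have hAint : ∀ η, Integrable A.F (ymSpecification ρ β Λ η) := by
      intro η
      haveI := isProbabilityMeasure_ymSpecification (d := 4) ρ hρc β Λ η
      exact Integrable.mono' (integrable_const CA) A.measurable.aestronglyMeasurable
        (Eventually.of_forall fun U => (Real.norm_eq_abs _).le.trans (hCA U))
    have hfint : ∀ η, ∫ U, f U ∂(ymSpecification ρ β Λ η) =
        (∫ U, A.F U ∂(ymSpecification ρ β Λ η)) / (2 * CA') + 1 / 2 := by
      intro η
      haveI := isProbabilityMeasure_ymSpecification (d := 4) ρ hρc β Λ η
      simp only [hf]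
      rw [integral_add ((hAint η).div_const _) (integrable_const _), integral_div, integral_const, smul_eq_mul]
      simp
    have hΔ : ∀ η η' : LGConfig 4 G,
        |(∫ U, A.F U ∂(ymSpecification ρ β Λ η)) - ∫ U, A.F U ∂(ymSpecification ρ β Λ η')| ≤ 2 * CA' * Δ := by
      intro η η'
      have h := hinfl η η'
      have hid : (∫ U, A.F U ∂(ymSpecification ρ β Λ η)) - ∫ U, A.F U ∂(ymSpecification ρ β Λ η') =
          2 * CA' * ((∫ U, f U ∂(ymSpecification ρ β Λ η)) - ∫ U, f U ∂(ymSpecification ρ β Λ η')) := by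
        rw [hfint η, hfint η']
        field_simp
        ring
      rw [hid, abs_mul, abs_of_pos (by positivity : (0 : ℝ) < 2 * CA')]
      exact mul_le_mul_of_nonneg_left h (by positivity)
    -- (i) the inner cells, the support of `A` and the collar inject into the torus
    have hmemΛ : ∀ e ∈ Λ, ∀ i, -((b : ℤ) * L) ≤ e.1 i ∧ e.1 i ≤ b * L + b - 1 := by
      intro e he i
      rw [hΛ, mem_regionEdges_iff hw1, mem_innerCells_iff] at he
      have hcell := (Summit.QuantumFields.YangMills.Cruxes.IR.CellTempered.Engine.frameCell_eq_iff hw1 e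
        (Summit.QuantumFields.YangMills.Cruxes.IR.CellTempered.Engine.frameCell w e)).1 rfl
      simp only [Summit.QuantumFields.YangMills.Cruxes.IR.Tempered.cellEdges, Finset.mem_product, Finset.mem_univ,
        and_true, Fintype.mem_piFinset, Finset.mem_Ico, hw] at hcell
      have h1 := hcell i
      have h2 := he i
      simp only [hx₀, hm] at h2; push_cast at h2
      have h3 : -(L : ℤ) ≤ Summit.QuantumFields.YangMills.Cruxes.IR.CellTempered.Engine.frameCell w e i := by
        linarith only [h2.1]
      have h4 : Summit.QuantumFields.YangMills.Cruxes.IR.CellTempered.Engine.frameCell w e i ≤ L := by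
        linarith only [h2.2]
      constructor
      · nlinarith only [h1.1, h3, hb1]
      · nlinarith only [h1.2, h4, hb1]
    have hwide : ∀ e ∈ Λ ∪ A.supp ∪ (plaquettesTouching Λ).biUnion plaquetteEdges, ∀ i,
        -((b : ℤ) * L) - 1 ≤ e.1 i ∧ e.1 i ≤ b * L + b := by
      intro e he i
      simp only [Finset.mem_union] at he
      rcases he with (he | he) | he
      · have h := hmemΛ e he i
        constructor <;> linarith only [h.1, h.2, hb1]
      · have h := abs_le.1 (hRA e he i)
        constructor <;> linarith only [h.1, h.2, hRAL, hLbL, hb1]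
      · obtain ⟨e', he', hn'⟩ := exists_near_of_mem_collar he
        have h := hmemΛ e' he' i
        have h' := hn' i
        constructor <;> linarith only [h.1, h.2, h'.1, h'.2]
    have hinj : Set.InjOn (Torus.proj (2 * S + 1))
        ((Λ ∪ A.supp ∪ (plaquettesTouching Λ).biUnion plaquetteEdges).image Prod.fst : Set (Site 4)) := by
      refine (injOn_torusProj_of_width' (M := 2 * S + 1) (lo := -((b : ℤ) * L) - 1)
        (hi := (b : ℤ) * L + b) (by
          have hRB0 : (0 : ℤ) ≤ RB := Nat.cast_nonneg RB
          push_cast; linarith only [hI1, hI2, hb1, hRB0])).mono fun x hx => ?_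
      obtain ⟨e, he, rfl⟩ := Finset.mem_image.1 (Finset.mem_coe.1 hx)
      exact hwide e he
    -- (ii) the torus image of the inner cells misses the translate of the support of `B`
    have hfar : ∀ e ∈ B.supp.image (fun e : ZdEdge 4 => (e.1 - -Pi.single 0 (t : ℤ), e.2)),
        ∀ e' ∈ Λ, torusEdge (2 * S + 1) e ≠ torusEdge (2 * S + 1) e' := by
      intro e he e' he' heq
      obtain ⟨e₀, he₀, rfl⟩ := Finset.mem_image.1 he
      have h0 := abs_le.1 (hRB e₀ he₀ 0)
      have h1 := hmemΛ e' he' 0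
      have hproj : ((e₀.1 0 + t : ℤ) : ZMod (2 * S + 1)) = ((e'.1 0 : ℤ) : ZMod (2 * S + 1)) := by
        have h := congr_fun (congr_arg Prod.fst heq) 0
        simp only [torusEdge] at h
        simpa [Torus.proj_apply] using h
      rw [ZMod.intCast_eq_intCast_iff_dvd_sub] at hproj
      have hpos : 0 < e₀.1 0 + t - e'.1 0 := by linarith only [h0.1, h1.2, hI1]
      have hlt' : e₀.1 0 + t - e'.1 0 < ((2 * S + 1 : ℕ) : ℤ) := by
        push_cast; linarith only [h0.2, h1.1, hI1, hI2, hb1]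
      have hdvd : (((2 * S + 1 : ℕ) : ℤ)) ∣ e₀.1 0 + t - e'.1 0 := by
        have h := hproj
        rwa [← neg_sub, dvd_neg] at h
      exact absurd (Int.le_of_dvd hpos hdvd) (not_le.2 hlt')
    -- (iii) the covariance bound on the torus
    have hcov := abs_latticeConnectedCorr_le_of_influence ρ hρc β (M := 2 * S + 1) Λ A.measurable
      B.measurable hCA hCB A.isCylinder B.isCylinder t hinj hfar hΔ
    -- (iv) compare with `C e^{−κ t/b}`
    have hu1 : (1 : ℝ) ≤ (k + 1 : ℝ) := by linarith only [(Nat.cast_nonneg k : (0 : ℝ) ≤ k)]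
    have hrind : ((rindCells x₀ m).card : ℝ) ≤ ((2 * RA + 3 : ℝ) * (k + 1)) ^ 4 := by
      have h1 : (rindCells x₀ m).card ≤ (boxCells x₀ m).card := Finset.card_le_card (rindCells_subset_boxCells x₀ m)
      have h2 : (boxCells x₀ m).card = m ^ 4 := by
        simp [boxCells, Fintype.card_piFinset, Int.card_Ico, Finset.prod_const]
      have h3 : ((rindCells x₀ m).card : ℝ) ≤ (m : ℝ) ^ 4 := by exact_mod_cast h2 ▸ h1
      have h4 : (m : ℝ) ≤ (2 * RA + 3 : ℝ) * (k + 1) := by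
        rw [hm, hL]; push_cast
        nlinarith only [(Nat.cast_nonneg k : (0 : ℝ) ≤ k), (Nat.cast_nonneg RA : (0 : ℝ) ≤ RA)]
      exact h3.trans (pow_le_pow_left₀ (Nat.cast_nonneg m) h4 4)
    have hθu : θ ^ (k + 1) = Real.exp (-(κ * (k + 1 : ℝ))) * Real.exp (-(κ * (k + 1 : ℝ))) := by
      rw [← Real.exp_add]; conv_lhs => rw [← Real.exp_log hθ, ← Real.exp_nat_mul]
      congr 1; rw [hlogκ]; push_cast; ring
    have hpoly : (k + 1 : ℝ) ^ 4 * Real.exp (-(κ * (k + 1 : ℝ))) ≤ 24 / κ ^ 4 :=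
      pow_four_mul_exp_neg_le hκ0 (by linarith only [hu1])
    -- `e^{-κ (k+1)} ≤ e^{κ c0 − κ t/b}`
    have hdecay : Real.exp (-(κ * (k + 1 : ℝ))) ≤ Real.exp (κ * c0 - κ * t / b) := by
      rw [Real.exp_le_exp]
      have htb : (t : ℝ) ≤ b * ((k + 1 : ℝ) + c0) := by
        have h1 : ((t - RB - P : ℕ) : ℝ) < k * b + b := by exact_mod_cast hlt
        have h0 : ((t - RB - P : ℕ) : ℝ) + RB + P = t := by exact_mod_cast ht_eq
        have h3 : (P : ℝ) = b * (RA + 1) := by rw [hP]; push_cast; ring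
        have h4 : (RB : ℝ) ≤ b * RB := le_mul_of_one_le_left (by positivity) hbR
        rw [hc0]
        nlinarith only [h1, h0, h3, h4, hbR]
      have htb' : κ * t / b ≤ κ * ((k + 1 : ℝ) + c0) := by
        rw [mul_div_assoc]
        exact mul_le_mul_of_nonneg_left ((div_le_iff₀ hbR0).2 (by linarith only [htb])) hκ0.le
      linarith only [htb']
    have hE0 : 0 ≤ Real.exp (-(κ * (k + 1 : ℝ))) := (Real.exp_pos _).le
    calc |latticeConnectedCorr ρ β (2 * S + 1) A.F B.F t|
        ≤ CB * (2 * CA' * (C₁ * Real.exp (Δf.card) * (rindCells x₀ m).card * θ ^ (k + 1))) := hcov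
      _ ≤ CB * (2 * CA' * (C₁ * Real.exp (Δf.card) * (((2 * RA + 3 : ℝ) * (k + 1)) ^ 4) * θ ^ (k + 1))) := by
          gcongr
      _ = 2 * CA' * CB * (C₁ * Real.exp (Δf.card) * (2 * RA + 3 : ℝ) ^ 4) *
            (((k + 1 : ℝ) ^ 4 * Real.exp (-(κ * (k + 1 : ℝ)))) * Real.exp (-(κ * (k + 1 : ℝ)))) := by
          rw [hθu]; ring
      _ ≤ 2 * CA' * CB * (C₁ * Real.exp (Δf.card) * (2 * RA + 3 : ℝ) ^ 4) *
            ((24 / κ ^ 4) * Real.exp (κ * c0 - κ * t / b)) := by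
          gcongr
      _ = 2 * CA' * CB * K * Real.exp (κ * c0 - κ * t / b) := by rw [hK]; ring
      _ ≤ 2 * (CA + 1) * CB * (1 + K) * Real.exp (κ * c0 - κ * t / b) := by
          rw [hCA']
          gcongr
          linarith

end Summit.QuantumFields.YangMills.Cruxes.IR.AfPincerUc.Port

end
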